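import Literature.AlgebraicGeometry.Frobenioids.GroupSubfunctorModelRigidity
import Literature.AlgebraicGeometry.Frobenioids.ModelFrobenioidPowerFunctor
import Literature.AlgebraicGeometry.Frobenioids.RealificationMapNotInjective
import HarnessLib

/-!
# Frobenioids I, Prop. 2.1 (i) / Prop. 2.5 (iii) at a realification: `C^rlf` is NOT rigid over its base —
# the Frobenius functor "multiplication by `d`" lies over the identity of `D`, preserves `deg_Fr`, and is
# not isomorphic to the identity (so `Div` IS load-bearing in the rigidity of
# `GroupSubfunctorModelRigidity.lean`); instance at THE `𝒞⊩_mod = C_{L/L}^rlf` of a number field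

Mochizuki, *The geometry of Frobenioids I: the general theory*, Kyushu J. Math. **62** (2008) 293–400:
Proposition 2.1 (i) p. 44 (the naive Frobenius functor of degree `d`, "`A ↦ A'`, `φ ↦ φ'` with
`φ' ∘ α_A = α_B ∘ φ`"; at the model Frobenioid of Thm. 5.2 (i) it is `(A_D, α) ↦ (A_D, d·α)`,
`(deg_Fr, Base, Div, u) ↦ (deg_Fr, Base, d·Div, d·u)` — abc-iut-L6-t10's `ModelFrobenioid.powFunctor`,
`ModelFrobenioidPowerFunctor.lean`); Proposition 2.5 (iii) p. 48–49 (the unit-linear Frobenius functor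
`Ψ : C ⥲ C(d)`, "(b) `Ψ` is 1-compatible, relative to the functors `C → F_Φ`, `C(d) → F_{d·Φ}` … with the
Frobenius functor associated to `d` on `F_Φ`" — i.e. it MULTIPLIES `Div` by `d`); Proposition 5.3 p. 103 (the
realification `C^rlf`); Example 6.3 p. 113 / Theorem 6.4 (i) p. 114 (the arithmetic Frobenioid and its
realification) [cite: MochizukiFrdI2008, Prop. 2.1 (i) p.44] [cite: MochizukiFrdI2008, Prop. 2.5 (iii) p.49]
[cite: MochizukiFrdI2008, Prop. 5.3 p.103] [cite: MochizukiFrdI2008, Thm. 6.4 (i) p.114].  Consumer locus: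
Mochizuki, *Inter-universal Teichmüller theory I*, Remark 5.2.1 (ii), kurims manuscript p. 143 l. 19–22
("the rigidity of the divisor monoids") [cite: Mochizuki2012, Rmk. 5.2.1 (ii) p.143] — abc-iut cell, L5 HUB
merge object (m4) / slot-law shapes «rigid over base» vs «rigid over `F_Φ`».

PROOF-ONLY companion (seat abc-iut-L1-t3 gen 11; no definitions) of `GroupSubfunctorModelRigidity.lean`
(this seat, p496532: every realification is rigid over base + `deg_Fr` + `Div`).  THIS FILE shows the
`Div`-hypothesis there cannot be dropped — a law «every endofunctor / self-equivalence of `C^rlf` lying over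
the identity of the base and preserving Frobenius degrees is `≅ 𝟭`» is FALSE at every realification with a
non-trivial divisor monoid over an object with trivial endomorphisms, in particular at THE `𝒞⊩_mod`:

* `ModelFrobenioid.powFunctor_comp_baseFunctor` / `degFr_powFunctor_map` / `div_powFunctor_map` — the
  Frobenius functor `powFunctor d` lies over `𝟙_D` ON THE NOSE and preserves `deg_Fr` (and raises `Div` to
  the `d`-th power);
* `ModelFrobenioid.pow_eq_pull_of_powFunctor_iso_id` — KEY (sharp `Φ`): a natural isomorphism
  `ι : powFunctor d ≅ 𝟭` forces `z ^ d = Φ(e_X)(z)` for every `z ∈ Φ(Base X)`, where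
  `e_X := Base(ι_X) ∈ Aut(Base X)` — read off the naturality square of `ι` at the pre-step `(1, id, z, 1)`
  (isomorphisms have `deg_Fr = 1`, and `Div = 0` for sharp `Φ`);
* `ModelFrobenioid.not_nonempty_powFunctor_iso_id` — hence if some object `A` of `D` has only the identity
  endomorphism and `Φ(A)` is sharp and cancellative with an element `z ≠ 1`, then `powFunctor d ≇ 𝟭` for every
  `d ≠ 1`;
* `PreFrobenioid.rlf_not_nonempty_powFunctor_iso_id` — at THE realification `C^rlf = PreFrobenioid.rlf F hΦ`
  (`Φ^rlf` sharp and cancellative: `IsPerfFactorial.Rlf.isSharp/isCancelMul`; a non-trivial `Φ(A)` gives a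
  non-trivial `Φ^rlf(A)` by `IsPerfFactorial.Rlf.toRealification_of_injective`);
* `FinSubextCat.hom_self_eq_id` — in `D = ℬ(Gal(L/L))⁰` (`FinSubextCat L L`) every endomorphism is the
  identity; `arithRlf_not_nonempty_powFunctor_iso_id` — **at THE genuine `𝒞⊩_mod := C_{L/L}^rlf` of a number
  field `L` (print's `F_mod`), for every `d ≠ 1` the degree-`d` Frobenius functor is an endofunctor over
  `𝟙_base` preserving `deg_Fr` that is NOT `≅ 𝟭`** (`arithRlf_exists_over_base_degFr_not_iso_id` packages the
  witness as `∃ Ψ, Ψ ⋙ Base = Base ∧ (∀ φ, deg_Fr (Ψ φ) = deg_Fr φ) ∧ ¬ Nonempty (Ψ ≅ 𝟭)`).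

Reading: the ⊩-side rigidity an [IUTchI] Ex. 3.5 collection consumes must be keyed over the STRUCTURE FUNCTOR
`𝒞⊩ → F_{Φ^rlf}` (base AND divisors — `GroupSubfunctorModelRigidity`), not over the base category alone; this is
print's own phenomenon (Prop. 2.5 (iii): for `Λ = ℝ` supporting `Φ^rlf`, the unit-linear Frobenius functor is a
self-equivalence of the underlying category onto `C(d)`).  OUR witness at OUR model categories; nothing of
either paper is restated as a fact; nothing here bears on [IUTchIII] Cor. 3.12.
-/

noncomputable section

namespace Literature.AlgebraicGeometry.Frobenioids

open CategoryTheory Opposite Literature.AnabelianGeometry.EtaleTheta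

universe w v u v' u'

namespace ModelFrobenioid

variable {D : Type u} [Category.{v} D] {Φ B : Dᵒᵖ ⥤ CommMonCat.{w}} {DivB : B ⟶ monoidGp Φ} (d : ℕ+)

/-- The Frobenius functor `powFunctor d` lies over the identity of the base ON THE NOSE
(`(A_D, α) ↦ (A_D, d·α)`, `Base(φ') = Base(φ)`). [cite: MochizukiFrdI2008, Prop. 2.1 (i) p.44] -/
theorem powFunctor_comp_baseFunctor :
    powFunctor Φ B DivB d ⋙ baseFunctor Φ B DivB = baseFunctor Φ B DivB := rfl

/-- The Frobenius functor preserves Frobenius degrees. [cite: MochizukiFrdI2008, Prop. 2.1 (i) p.44] -/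
theorem degFr_powFunctor_map {X Y : ModelFrobenioid Φ B DivB} (φ : X ⟶ Y) :
    degFr ((powFunctor Φ B DivB d).map φ) = degFr φ := rfl

/-- The Frobenius functor raises zero divisors to the `d`-th power ("the Frobenius functor associated to `d`
on `F_Φ`", Prop. 2.5 (iii)(b)). [cite: MochizukiFrdI2008, Prop. 2.5 (iii) p.49] -/
theorem div_powFunctor_map {X Y : ModelFrobenioid Φ B DivB} (φ : X ⟶ Y) :
    div ((powFunctor Φ B DivB d).map φ) = div φ ^ (d : ℕ) := rfl

/-- In a model Frobenioid with SHARP `Φ`, an isomorphism has trivial zero divisor (`deg_Fr` of an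
isomorphism is `1`, `degFr_eq_one_of_isIso`; then `Div(φ) · Base(φ)^*Div(φ⁻¹) = Div(id) = 0`).
[cite: MochizukiFrdI2008, Thm. 5.2 (i) p.100] -/
theorem div_eq_one_of_isIso_of_isSharp (hΦ : ∀ A : Dᵒᵖ, IsSharp (Φ.obj A))
    {X Y : ModelFrobenioid Φ B DivB} (φ : X ⟶ Y) [IsIso φ] : div φ = 1 := by
  have h := congrArg div (IsIso.hom_inv_id φ)
  rw [div_comp, div_id, degFr_eq_one_of_isIso (inv φ), PNat.one_coe, pow_one] at h
  exact (hΦ _).eq_one_of_isUnit _ (IsUnit.of_mul_eq_one_right _ h)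

/-- **KEY**: a natural isomorphism `ι : powFunctor d ≅ 𝟭` forces, for every object `X = (A, α)` and every
`z ∈ Φ(A)`, `z ^ d = Φ(e_X)(z)` with `e_X := Base(ι_X) : A ⟶ A` — the `Div`-component of the naturality square
of `ι` at the pre-step `(1, id, z, 1) : (A, α) → (A, α + z)` (sharp `Φ`: the components of `ι` have `deg_Fr = 1`
and `Div = 0`). [cite: MochizukiFrdI2008, Prop. 2.1 (i) p.44] -/
theorem pow_eq_pull_of_powFunctor_iso_id (hΦ : ∀ A : Dᵒᵖ, IsSharp (Φ.obj A))
    (ι : powFunctor Φ B DivB d ≅ 𝟭 (ModelFrobenioid Φ B DivB)) (X : ModelFrobenioid Φ B DivB)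
    (z : Φ.obj (op X.base)) :
    z ^ (d : ℕ) = (Φ.map (baseMap (ι.hom.app X)).op).hom z := by
  -- the pre-step `(1, id, z, 1) : (A, α) → (A, α + z)`
  let X' : ModelFrobenioid Φ B DivB := ⟨X.base, X.cls * Algebra.GrothendieckGroup.of z⟩
  let s : X ⟶ X' :=
    { degFr := 1
      base := 𝟙 X.base
      div := z
      unit := 1
      rel := by
        show X.cls ^ ((1 : ℕ+) : ℕ) * _ = pullGp Φ (𝟙 X.base) (X.cls * Algebra.GrothendieckGroup.of z) * _
        rw [PNat.one_coe, pow_one, pullGp_id, map_one, mul_one] }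
  -- naturality of `ι` at `s`, read on `Div`
  have hnat := congrArg div (ι.hom.naturality s)
  rw [Functor.id_map, div_comp, div_comp, div_eq_one_of_isIso_of_isSharp hΦ (ι.hom.app X'),
    div_eq_one_of_isIso_of_isSharp hΦ (ι.hom.app X), map_one, one_mul, one_pow, mul_one,
    degFr_eq_one_of_isIso (ι.hom.app X'), PNat.one_coe, pow_one] at hnat
  -- `hnat : div ((powFunctor d).map s) = Φ(Base ι_X) (div s)`, i.e. `z ^ d = Φ(e_X)(z)` on the nose
  exact hnat

/-- **`powFunctor d ≇ 𝟭`** as soon as some object `A` of the base has only the identity endomorphism while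
`Φ(A)` is sharp, cancellative and non-trivial (`d ≠ 1`): the key identity would read `z ^ d = z`, i.e.
`z ^ (d-1) = 1`, i.e. `z = 1`. [cite: MochizukiFrdI2008, Prop. 2.1 (i) p.44] -/
theorem not_nonempty_powFunctor_iso_id (hΦ : ∀ A : Dᵒᵖ, IsSharp (Φ.obj A)) (hd : d ≠ 1)
    (A : D) (hA : ∀ e : A ⟶ A, e = 𝟙 A) [IsCancelMul (Φ.obj (op A))]
    (z : Φ.obj (op A)) (hz : z ≠ 1) :
    ¬ Nonempty (powFunctor Φ B DivB d ≅ 𝟭 (ModelFrobenioid Φ B DivB)) := by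
  rintro ⟨ι⟩
  have h := pow_eq_pull_of_powFunctor_iso_id d hΦ ι ⟨A, 1⟩ z
  rw [hA (baseMap (ι.hom.app ⟨A, 1⟩))] at h
  -- `Φ(𝟙_A) = id`
  have h' : z ^ (d : ℕ) = (Φ.map (𝟙 (op A))).hom z := h
  rw [Φ.map_id] at h'
  change z ^ (d : ℕ) = z at h'
  -- `z ^ (d - 1) * z = 1 * z`, cancel, torsion-freeness of the sharp monoid `Φ(A)`
  have hdpos : 0 < (d : ℕ) := d.pos
  have hne : (d : ℕ) ≠ 1 := fun h1 => hd (PNat.coe_eq_one_iff.mp h1)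
  have hd1 : 0 < (d : ℕ) - 1 := by omega
  have hsplit : z ^ ((d : ℕ) - 1) * z = 1 * z := by
    rw [one_mul, ← pow_succ, Nat.sub_add_cancel (Nat.succ_le_of_lt hdpos), h']
  exact hz ((hΦ (op A)).isTorsionFree.eq_one_of_pow_eq_one z _ hd1 (mul_right_cancel hsplit))

end ModelFrobenioid

/-! ### At THE realification `C^rlf` (Prop. 5.3) -/

namespace PreFrobenioid

variable {D : Type u} [Category.{v} D] {Φ : Dᵒᵖ ⥤ CommMonCat.{w}}
  {C : Type u'} [Category.{v'} C] (F : C ⥤ ElemFrobenioid Φ) (hΦ : IsPerfFactorialOn Φ) (d : ℕ+)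

/-- **`C^rlf` is NOT rigid over its base**: at THE realification of a Frobenioid structure functor `F` with
perf-factorial `Φ`, if some object `A` of `D` has only the identity endomorphism and `Φ(A)` is non-trivial,
then the degree-`d` Frobenius functor (`d ≠ 1`) — an endofunctor over `𝟙_D` preserving `deg_Fr` — is not
`≅ 𝟭` (`Φ^rlf(A)` is sharp, cancellative, and `Φ(A) → Φ(A)^pf → Φ(A)^rlf` is injective).
[cite: MochizukiFrdI2008, Prop. 5.3 p.103] -/
theorem rlf_not_nonempty_powFunctor_iso_id (hd : d ≠ 1) (A : D) (hA : ∀ e : A ⟶ A, e = 𝟙 A)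
    (m : Φ.obj (op A)) (hm : m ≠ 1) :
    ¬ Nonempty (ModelFrobenioid.powFunctor _ _ _ d ≅ 𝟭 (rlf F hΦ)) := by
  haveI : IsCancelMul ((RealificationData.canonical Φ (IsPerfFactorialOn.op hΦ)).rlf.obj (op A)) :=
    IsPerfFactorial.Rlf.isCancelMul (IsPerfFactorialOn.op hΦ (op A))
  have hz : (IsPerfFactorialOn.op hΦ (op A)).toRealification (Perfection.of _ m) ≠ 1 := fun h1 =>
    hm (IsPerfFactorial.Rlf.toRealification_of_injective (IsPerfFactorialOn.op hΦ (op A))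
      (h1.trans (map_one _).symm))
  exact ModelFrobenioid.not_nonempty_powFunctor_iso_id d
    (fun X => IsPerfFactorial.Rlf.isSharp (IsPerfFactorialOn.op hΦ X)) hd A hA _ hz

end PreFrobenioid

/-! ### At THE realified arithmetic Frobenioid `𝒞⊩_mod = C_{L/L}^rlf` (Ex. 6.3 / Thm. 6.4 (i)) -/

section Arith

open NumberField

variable (L : Type) [Field L] [NumberField L]

omit [NumberField L] in
/-- In `D = ℬ(Gal(L/L))⁰` (finite subextensions of `L/L`) every endomorphism of an object is the identity:
an `L`-algebra endomorphism of an intermediate field of `L/L` fixes every element, each being in the image of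
`L`. [cite: MochizukiFrdI2008, Ex. 6.3 p.113] -/
theorem FinSubextCat.hom_self_eq_id (X : FinSubextCat L L) (e : X ⟶ X) : e = 𝟙 X := by
  apply FinSubextCat.hom_ext
  apply AlgHom.ext
  intro x
  have hx : x = algebraMap L X.L (x : L) := Subtype.ext (by simp)
  rw [hx, AlgHom.commutes]
  rfl

/-- A non-zero effective arithmetic divisor on `L`: the one with archimedean part `1` at every infinite place
(`Φ(L) ≠ 0`, Ex. 6.3 p. 113). [cite: MochizukiFrdI2008, Ex. 6.3 p.113] -/
theorem EffArithDivisor.ofAdd_arch_one_ne_one (M : Type) [Field M] [NumberField M] :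
    (Multiplicative.ofAdd ((0, fun _ => 1) : EffArithDivisor M)) ≠ 1 := by
  intro h
  have h' := congrArg (fun D : Multiplicative (EffArithDivisor M) => (Multiplicative.toAdd D).2) h
  obtain ⟨w⟩ := (inferInstance : Nonempty (InfinitePlace M))
  have := congrFun h' w
  simp at this

/-- **THE genuine `𝒞⊩_mod` is NOT rigid over its base**: at `𝒞⊩_mod := C_{L/L}^rlf` (print's `F_mod`), for
every `d ≠ 1` the degree-`d` Frobenius functor — an endofunctor lying over `𝟙_base` on the nose and preserving
Frobenius degrees (`powFunctor_comp_baseFunctor`, `degFr_powFunctor_map`) — is NOT isomorphic to the identity.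
Hypothesis-free. [cite: MochizukiFrdI2008, Thm. 6.4 (i) p.114] -/
theorem arithRlf_not_nonempty_powFunctor_iso_id (d : ℕ+) (hd : d ≠ 1) :
    ¬ Nonempty (ModelFrobenioid.powFunctor _ _ _ d ≅
        𝟭 (PreFrobenioid.rlf
              (ModelFrobenioid.toElem (arithDivisorFunctor L L) (unitsFunctor L L) (divNatTrans L L))
              (arith_objectwise_isPerfFactorial L L))) :=
  PreFrobenioid.rlf_not_nonempty_powFunctor_iso_id _ (arith_objectwise_isPerfFactorial L L) d hd
    ⟨⊤⟩ (FinSubextCat.hom_self_eq_id L ⟨⊤⟩) _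
    (EffArithDivisor.ofAdd_arch_one_ne_one (FinSubextCat.L (⟨⊤⟩ : FinSubextCat L L)))

/-- **Witness, packaged** (the shape a «rigid over base» LAW would negate): at THE genuine `𝒞⊩_mod` there is
an endofunctor `Ψ` with `Ψ ⋙ Base = Base`, preserving every Frobenius degree, and `¬ (Ψ ≅ 𝟭)` — the
degree-`2` Frobenius functor.  Contrast `arithRlf_nonempty_iso_id_of_over_base` (p496532): adding the
`Div`-compatibility makes every such `Ψ` isomorphic to `𝟭`. [cite: MochizukiFrdI2008, Thm. 6.4 (i) p.114] -/
theorem arithRlf_exists_over_base_degFr_not_iso_id :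
    ∃ Ψ : PreFrobenioid.rlf
          (ModelFrobenioid.toElem (arithDivisorFunctor L L) (unitsFunctor L L) (divNatTrans L L))
          (arith_objectwise_isPerfFactorial L L) ⥤
        PreFrobenioid.rlf
          (ModelFrobenioid.toElem (arithDivisorFunctor L L) (unitsFunctor L L) (divNatTrans L L))
          (arith_objectwise_isPerfFactorial L L),
      Ψ ⋙ ModelFrobenioid.baseFunctor _ _ _ = ModelFrobenioid.baseFunctor _ _ _ ∧
      (∀ ⦃X Y⦄ (φ : X ⟶ Y), ModelFrobenioid.degFr (Ψ.map φ) = ModelFrobenioid.degFr φ) ∧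
      ¬ Nonempty (Ψ ≅ 𝟭 _) :=
  ⟨ModelFrobenioid.powFunctor _ _ _ 2, rfl, fun _ _ _ => rfl,
    arithRlf_not_nonempty_powFunctor_iso_id L 2 (by decide)⟩

end Arith

end Literature.AlgebraicGeometry.Frobenioids

end
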